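import Literature.Analysis.FluidPDE.ClassicalLerayProjection
import Literature.Analysis.FluidPDE.NSLocalAnalyticityRadius
import Literature.Analysis.FluidPDE.MildSolution
import HarnessLib

/-!
# Localisation of a classical solution in a cylinder: the objects of the engine proving the
# local analyticity radius (Bradshaw–Grujić–Kukavica 2015)

Analysis/FluidPDE definitions file, module L0 of the proof of the named fact
`Literature.Analysis.FluidPDE.bradshawGrujicKukavica2015_local_analyticity_radius`
(`NSLocalAnalyticityRadius.lean`; Bradshaw–Grujić–Kukavica, J. Differential Equations 259
(2015), Thm. 2.3, proof §4; LMS Lecture Note Ser. 430 (2016), Thm. 2.3.1). The fact is reduced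
in the tree (`bradshawGrujicKukavica2015_local_analyticity_radius_of_small`,
`NSLocalAnalyticityRadiusUnitScale.lean`) to a small-data unit-scale core about a classical
solution `(u, p)` of the Navier–Stokes equations (`ν = 1`, no force) on an open cylinder
`(-δ, R²) × B(x₁, R)`. The printed proof (BGK 2015, §4: "let `v = φu` … `v` satisfies the
inhomogeneous system (4.2)–(4.3) on the whole space") localises the solution with a smooth
cut-off and runs the analyticity argument on the localised field. This file fixes the
vocabulary of that localisation, in the tree's language:

* `IsCylinderSolution x₁ δ R u p` — the four classical hypotheses of the core (joint smoothness
  of `u`, `p` on the open cylinder, the momentum equation with the genuine time derivative,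
  incompressibility), and `IsSmallCylinderSolution x₁ δ R ε₀ u p` — the same with the three
  smallness bounds of the core (`‖u(t)‖_{L³(B_R)} ≤ ε₀`, `‖p(t)‖_{L^{3/2}(B_R)} ≤ ε₀`,
  `∫₀^{R²} ‖∇u‖²_{L²(B_R)} ≤ ε₀²`); `IsSmallCylinderSolution.of_hypotheses` repackages the seven
  inline hypotheses of `bradshawGrujicKukavica2015_local_analyticity_radius_of_small`;
* `IsLocCutoff x₁ R χ` — a smooth cut-off `0 ≤ χ ≤ 1` supported in `B̄(x₁, R - 3)` and `≡ 1`
  on `B̄(x₁, R - 4)`;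
* the localised objects (BGK 2015, (4.1)–(4.3), in the Leray-projected form used by the tree):
  the localised velocity `locVelocity χ u t = χ u(t)` (`v`), the bounded extension
  `locExtension x₁ R u t = 1_{B(x₁,R-2)} u(t)` (`ũ`), the divergence `locDivergence χ u t = ∇χ·u(t)`
  (`= div v`), the commutator force `locForce χ u p t = (Δχ)u + (u·∇χ)u + p∇χ` (`f₀`), the
  Newtonian potential of the divergence `locPotential χ u t = π[v(t)]` (`divPotential`,
  `ClassicalLerayProjection.lean`), its gradient `locGradPart` (`b = ∇π[v]`) and the solenoidal
  part `locSolPart χ u t = P[v(t)]` (`a = classicalLerayProj v`), with `a + b = v`;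
* the terms of the Oseen representation of `a` that are not bilinear: the caloric datum term
  `locDatum χ u s₀ t = e^{(t-s₀)Δ}a(s₀)` (`heatFlow`), the projected commutator force
  `locProjForce χ u p s = P[f₀(s)]` and its Duhamel integral
  `locForcing χ u p s₀ t = ∫_{(s₀,t)} e^{(t-s)Δ}P[f₀(s)] ds`.

Only unfolding lemmas and the pointwise algebra are proved here; regularity, the duality
identity and the Oseen representation of `a` are the next layers.

## Mathlib / tree search

Tree: `divPotential`, `classicalLerayProj`, `classicalLerayProj_add_gradient`
(`ClassicalLerayProjection.lean`); `convect`, `VectorCalculus.divergence`, `gradient`,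
`InnerProductSpace.laplacian`; the reduced core
`bradshawGrujicKukavica2015_local_analyticity_radius_of_small`
(`NSLocalAnalyticityRadiusUnitScale.lean`, whose hypotheses these structures bundle). No
localisation vocabulary for cylinder solutions exists in the tree (`lean search
'locVelocity|IsCylinderSolution|localis'`).

## References

* Z. Bradshaw, Z. Grujić, I. Kukavica, *Local analyticity radii of solutions to the 3D
  Navier–Stokes equations with locally analytic forcing*, J. Differential Equations 259 (2015),
  §4, (4.1)–(4.3) (the localised field `v = φu` and its system). [BradshawGrujicKukavica2015]
* Z. Bradshaw, Z. Grujić, I. Kukavica, in: LMS Lecture Note Ser. 430, CUP 2016, Thm. 2.3.1.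
  [BradshawGrujicKukavica2016]
* A. J. Majda, A. L. Bertozzi, *Vorticity and Incompressible Flow*, CUP 2002, §1.8 Prop. 1.16
  (the Leray–Helmholtz decomposition `v = P v + ∇q`). [MajdaBertozziCUP2002]
-/

noncomputable section

open MeasureTheory Set Function Filter Metric Real
open _root_.Topology
open scoped ENNReal ContDiff Laplacian InnerProductSpace RealInnerProductSpace

namespace Literature.Analysis.FluidPDE

namespace BGK2015

/-! ### Classical solutions on the cylinder `(-δ, R²) × B(x₁, R)` -/

/-- **A classical solution of the Navier–Stokes equations on the open cylinder
`(-δ, R²) × B(x₁, R)`** (`ν = 1`, no force): `u`, `p` jointly `C^∞` on the cylinder,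
`∂ₜu + (u·∇)u = Δu − ∇p` (genuine partial time derivative, the cylinder being open) and
`div u = 0` at every point of the cylinder — verbatim the first four inline hypotheses of the
reduced core `bradshawGrujicKukavica2015_local_analyticity_radius_of_small`. [folklore] -/
structure IsCylinderSolution (x₁ : EuclideanSpace ℝ (Fin 3)) (δ R : ℝ)
    (u : ℝ → EuclideanSpace ℝ (Fin 3) → EuclideanSpace ℝ (Fin 3))
    (p : ℝ → EuclideanSpace ℝ (Fin 3) → ℝ) : Prop where
  /-- The velocity is jointly smooth on the open cylinder. -/
  smooth_velocity : ContDiffOn ℝ ∞ (uncurry u) (Ioo (-δ) (R ^ 2) ×ˢ ball x₁ R)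
  /-- The pressure is jointly smooth on the open cylinder. -/
  smooth_pressure : ContDiffOn ℝ ∞ (uncurry p) (Ioo (-δ) (R ^ 2) ×ˢ ball x₁ R)
  /-- The momentum equation `∂ₜu + (u·∇)u = Δu − ∇p` on the cylinder. -/
  momentum : ∀ t ∈ Ioo (-δ) (R ^ 2), ∀ x ∈ ball x₁ R,
    deriv (fun s => u s x) t + convect (u t) (u t) x = Δ (u t) x - gradient (p t) x
  /-- Incompressibility on the cylinder. -/
  divFree : ∀ t ∈ Ioo (-δ) (R ^ 2), ∀ x ∈ ball x₁ R, VectorCalculus.divergence (u t) x = 0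

/-- **A small classical solution on the cylinder**: a classical solution with the three
smallness bounds of the reduced core — `‖u(t)‖_{L³(B(x₁,R))} ≤ ε₀` and
`‖p(t)‖_{L^{3/2}(B(x₁,R))} ≤ ε₀` for every `t ∈ (-δ, R²)`, and
`∫_{(0,R²)} ‖∇u(t)‖²_{L²(B(x₁,R))} dt ≤ ε₀²` — verbatim the last three inline hypotheses of
`bradshawGrujicKukavica2015_local_analyticity_radius_of_small`. [folklore] -/
structure IsSmallCylinderSolution (x₁ : EuclideanSpace ℝ (Fin 3)) (δ R ε₀ : ℝ)
    (u : ℝ → EuclideanSpace ℝ (Fin 3) → EuclideanSpace ℝ (Fin 3))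
    (p : ℝ → EuclideanSpace ℝ (Fin 3) → ℝ) : Prop
    extends IsCylinderSolution x₁ δ R u p where
  /-- `‖u(t)‖_{L³(B(x₁, R))} ≤ ε₀` for all times. -/
  velocity_L3 : ∀ t ∈ Ioo (-δ) (R ^ 2),
    eLpNorm (u t) 3 (volume.restrict (ball x₁ R)) ≤ ENNReal.ofReal ε₀
  /-- `‖p(t)‖_{L^{3/2}(B(x₁, R))} ≤ ε₀` for all times. -/
  pressure_L32 : ∀ t ∈ Ioo (-δ) (R ^ 2),
    eLpNorm (p t) (ENNReal.ofReal (3 / 2)) (volume.restrict (ball x₁ R)) ≤ ENNReal.ofReal ε₀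
  /-- `∫_{(0,R²)} ‖∇u(t)‖²_{L²(B(x₁, R))} dt ≤ ε₀²`. -/
  gradient_L2 : ∫⁻ t in Ioo 0 (R ^ 2),
    eLpNorm (fun x => Real.sqrt (frobeniusNormSq (fderiv ℝ (u t) x))) 2
      (volume.restrict (ball x₁ R)) ^ (2 : ℝ) ≤ ENNReal.ofReal (ε₀ ^ 2)

/-- Repackaging of the seven inline hypotheses of the reduced core as
`IsSmallCylinderSolution`. [folklore] -/
theorem IsSmallCylinderSolution.of_hypotheses {x₁ : EuclideanSpace ℝ (Fin 3)} {δ R ε₀ : ℝ}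
    {u : ℝ → EuclideanSpace ℝ (Fin 3) → EuclideanSpace ℝ (Fin 3)}
    {p : ℝ → EuclideanSpace ℝ (Fin 3) → ℝ}
    (hu : ContDiffOn ℝ ∞ (uncurry u) (Ioo (-δ) (R ^ 2) ×ˢ ball x₁ R))
    (hp : ContDiffOn ℝ ∞ (uncurry p) (Ioo (-δ) (R ^ 2) ×ˢ ball x₁ R))
    (hns : ∀ t ∈ Ioo (-δ) (R ^ 2), ∀ x ∈ ball x₁ R,
      deriv (fun s => u s x) t + convect (u t) (u t) x = Δ (u t) x - gradient (p t) x)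
    (hdiv : ∀ t ∈ Ioo (-δ) (R ^ 2), ∀ x ∈ ball x₁ R, VectorCalculus.divergence (u t) x = 0)
    (hu3 : ∀ t ∈ Ioo (-δ) (R ^ 2),
      eLpNorm (u t) 3 (volume.restrict (ball x₁ R)) ≤ ENNReal.ofReal ε₀)
    (hp32 : ∀ t ∈ Ioo (-δ) (R ^ 2),
      eLpNorm (p t) (ENNReal.ofReal (3 / 2)) (volume.restrict (ball x₁ R)) ≤ ENNReal.ofReal ε₀)
    (hgrad : ∫⁻ t in Ioo 0 (R ^ 2),
      eLpNorm (fun x => Real.sqrt (frobeniusNormSq (fderiv ℝ (u t) x))) 2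
        (volume.restrict (ball x₁ R)) ^ (2 : ℝ) ≤ ENNReal.ofReal (ε₀ ^ 2)) :
    IsSmallCylinderSolution x₁ δ R ε₀ u p :=
  ⟨⟨hu, hp, hns, hdiv⟩, hu3, hp32, hgrad⟩

/-! ### The cut-off -/

/-- **An admissible localisation cut-off**: `χ ∈ C^∞(ℝ³)`, `0 ≤ χ ≤ 1`, supported in the
closed ball `B̄(x₁, R - 3)` and identically `1` on `B̄(x₁, R - 4)` (BGK 2015, §4: "`φ` a smooth
cut-off, `φ = 1` on `B_{r}`, supported in `B_{2r}`"; here with the margins of the tree's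
reduction). [folklore] -/
structure IsLocCutoff (x₁ : EuclideanSpace ℝ (Fin 3)) (R : ℝ) (χ : EuclideanSpace ℝ (Fin 3) → ℝ) :
    Prop where
  /-- The cut-off is smooth. -/
  contDiff : ContDiff ℝ ∞ χ
  /-- The cut-off is supported in `B̄(x₁, R - 3)`. -/
  tsupport_subset : tsupport χ ⊆ closedBall x₁ (R - 3)
  /-- The cut-off is `≡ 1` on `B̄(x₁, R - 4)`. -/
  eq_one : ∀ x ∈ closedBall x₁ (R - 4), χ x = 1
  /-- `0 ≤ χ`. -/
  nonneg : ∀ x, 0 ≤ χ x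
  /-- `χ ≤ 1`. -/
  le_one : ∀ x, χ x ≤ 1

/-! ### The localised objects -/

/-- **The localised velocity** `v(t) = χ u(t)` (BGK 2015, §4, `v = φu`), a field on the whole
space (the values of `u` off the cylinder are irrelevant: `χ` vanishes there). [folklore] -/
def locVelocity (χ : EuclideanSpace ℝ (Fin 3) → ℝ)
    (u : ℝ → EuclideanSpace ℝ (Fin 3) → EuclideanSpace ℝ (Fin 3)) (t : ℝ)
    (x : EuclideanSpace ℝ (Fin 3)) : EuclideanSpace ℝ (Fin 3) :=
  χ x • u t x

/-- **The bounded extension** `ũ(t) = 1_{B(x₁, R - 2)} u(t)` of the velocity by zero off the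
ball `B(x₁, R - 2)` (a bounded measurable field on the whole space once `u` is bounded on that
ball; it multiplies only factors supported in `B̄(x₁, R - 3)`, where it is `u`). [folklore] -/
def locExtension (x₁ : EuclideanSpace ℝ (Fin 3)) (R : ℝ)
    (u : ℝ → EuclideanSpace ℝ (Fin 3) → EuclideanSpace ℝ (Fin 3)) (t : ℝ) :
    EuclideanSpace ℝ (Fin 3) → EuclideanSpace ℝ (Fin 3) :=
  (ball x₁ (R - 2)).indicator (u t)

/-- **The divergence of the localised velocity**, `g(t) = ∇χ · u(t) = Dχ(u(t))`
(`= div v(t)` because `div u = 0`; BGK 2015, (4.3): `∇·v = ∇φ·u`). [folklore] -/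
def locDivergence (χ : EuclideanSpace ℝ (Fin 3) → ℝ)
    (u : ℝ → EuclideanSpace ℝ (Fin 3) → EuclideanSpace ℝ (Fin 3)) (t : ℝ)
    (x : EuclideanSpace ℝ (Fin 3)) : ℝ :=
  fderiv ℝ χ x (u t x)

/-- **The commutator force of the localisation**, `f₀(t) = (Δχ) u + (u·∇χ) u + p ∇χ` — the
non-divergence part of the right-hand side of the localised system (BGK 2015, (4.2): the terms
of `φ(uₜ - Δu + (u·∇)u + ∇p) = 0` in which derivatives fall on `φ`); supported in the cut-off
annulus. [folklore] -/
def locForce (χ : EuclideanSpace ℝ (Fin 3) → ℝ)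
    (u : ℝ → EuclideanSpace ℝ (Fin 3) → EuclideanSpace ℝ (Fin 3))
    (p : ℝ → EuclideanSpace ℝ (Fin 3) → ℝ) (t : ℝ) (x : EuclideanSpace ℝ (Fin 3)) :
    EuclideanSpace ℝ (Fin 3) :=
  (Δ χ) x • u t x + (fderiv ℝ χ x (u t x)) • u t x + p t x • gradient χ x

/-- **The Newtonian potential of the divergence of the localised velocity**,
`π(t) = π[v(t)] = Γ ⋆ div v(t)` (`divPotential`, `ClassicalLerayProjection.lean`). [folklore] -/
def locPotential (χ : EuclideanSpace ℝ (Fin 3) → ℝ)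
    (u : ℝ → EuclideanSpace ℝ (Fin 3) → EuclideanSpace ℝ (Fin 3)) (t : ℝ) :
    EuclideanSpace ℝ (Fin 3) → ℝ :=
  divPotential (locVelocity χ u t)

/-- **The gradient part of the localised velocity**, `b(t) = ∇π[v(t)]` (the gradient component
of the Leray–Helmholtz decomposition `v = P v + ∇π[v]`, Majda–Bertozzi 2002, Prop. 1.16).
[folklore] -/
def locGradPart (χ : EuclideanSpace ℝ (Fin 3) → ℝ)
    (u : ℝ → EuclideanSpace ℝ (Fin 3) → EuclideanSpace ℝ (Fin 3)) (t : ℝ) :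
    EuclideanSpace ℝ (Fin 3) → EuclideanSpace ℝ (Fin 3) :=
  gradient (locPotential χ u t)

/-- **The solenoidal part of the localised velocity**, `a(t) = P[v(t)] = v(t) - ∇π[v(t)]`
(`classicalLerayProj`). [folklore] -/
def locSolPart (χ : EuclideanSpace ℝ (Fin 3) → ℝ)
    (u : ℝ → EuclideanSpace ℝ (Fin 3) → EuclideanSpace ℝ (Fin 3)) (t : ℝ) :
    EuclideanSpace ℝ (Fin 3) → EuclideanSpace ℝ (Fin 3) :=
  classicalLerayProj (locVelocity χ u t)

/-- **The caloric datum term** of the Oseen representation from the base time `s₀`: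
`e^{(t-s₀)Δ}a(s₀)` (`heatFlow`, which is the identity for `t ≤ s₀`). [folklore] -/
def locDatum (χ : EuclideanSpace ℝ (Fin 3) → ℝ)
    (u : ℝ → EuclideanSpace ℝ (Fin 3) → EuclideanSpace ℝ (Fin 3)) (s₀ t : ℝ) :
    EuclideanSpace ℝ (Fin 3) → EuclideanSpace ℝ (Fin 3) :=
  heatFlow (locSolPart χ u s₀) (t - s₀)

/-- **The projected commutator force** `P[f₀(s)] = f₀(s) - ∇π[f₀(s)]` (classical Leray
projection of the `C_c^∞` field `f₀(s)`). [folklore] -/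
def locProjForce (χ : EuclideanSpace ℝ (Fin 3) → ℝ)
    (u : ℝ → EuclideanSpace ℝ (Fin 3) → EuclideanSpace ℝ (Fin 3))
    (p : ℝ → EuclideanSpace ℝ (Fin 3) → ℝ) (s : ℝ) :
    EuclideanSpace ℝ (Fin 3) → EuclideanSpace ℝ (Fin 3) :=
  classicalLerayProj (locForce χ u p s)

/-- **The forcing term** of the Oseen representation: the Duhamel integral
`∫_{(s₀,t)} e^{(t-s)Δ}P[f₀(s)] ds` of the projected commutator force (Bochner integral in `s`,
pointwise in `x`). [folklore] -/
def locForcing (χ : EuclideanSpace ℝ (Fin 3) → ℝ)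
    (u : ℝ → EuclideanSpace ℝ (Fin 3) → EuclideanSpace ℝ (Fin 3))
    (p : ℝ → EuclideanSpace ℝ (Fin 3) → ℝ) (s₀ t : ℝ) (x : EuclideanSpace ℝ (Fin 3)) :
    EuclideanSpace ℝ (Fin 3) :=
  ∫ s in Ioo s₀ t, heatFlow (locProjForce χ u p s) (t - s) x

/-! ### Unfolding lemmas and pointwise algebra -/

section Unfold

variable (χ : EuclideanSpace ℝ (Fin 3) → ℝ) (x₁ : EuclideanSpace ℝ (Fin 3)) (R : ℝ)
  (u : ℝ → EuclideanSpace ℝ (Fin 3) → EuclideanSpace ℝ (Fin 3))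
  (p : ℝ → EuclideanSpace ℝ (Fin 3) → ℝ) (t : ℝ) (x : EuclideanSpace ℝ (Fin 3))

/-- Unfolding `locVelocity`. [folklore] -/
theorem locVelocity_apply : locVelocity χ u t x = χ x • u t x := rfl

/-- Unfolding `locExtension`. [folklore] -/
theorem locExtension_apply : locExtension x₁ R u t x = (ball x₁ (R - 2)).indicator (u t) x := rfl

/-- Unfolding `locDivergence`. [folklore] -/
theorem locDivergence_apply : locDivergence χ u t x = fderiv ℝ χ x (u t x) := rfl

/-- Unfolding `locForce`. [folklore] -/
theorem locForce_apply :
    locForce χ u p t x = (Δ χ) x • u t x + (fderiv ℝ χ x (u t x)) • u t x + p t x • gradient χ x :=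
  rfl

/-- Unfolding `locPotential`. [folklore] -/
theorem locPotential_eq : locPotential χ u t = divPotential (locVelocity χ u t) := rfl

/-- Unfolding `locGradPart`. [folklore] -/
theorem locGradPart_eq : locGradPart χ u t = gradient (locPotential χ u t) := rfl

/-- Unfolding `locSolPart`. [folklore] -/
theorem locSolPart_eq : locSolPart χ u t = classicalLerayProj (locVelocity χ u t) := rfl

/-- Unfolding `locDatum`. [folklore] -/
theorem locDatum_eq (s₀ : ℝ) : locDatum χ u s₀ t = heatFlow (locSolPart χ u s₀) (t - s₀) := rfl

/-- At the base time the datum term is `a(s₀)` itself (`e^{0Δ} = id`). [folklore] -/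
theorem locDatum_self (s₀ : ℝ) : locDatum χ u s₀ s₀ = locSolPart χ u s₀ := by
  rw [locDatum_eq, sub_self, heatFlow_zero]

/-- Unfolding `locProjForce`. [folklore] -/
theorem locProjForce_eq : locProjForce χ u p t = classicalLerayProj (locForce χ u p t) := rfl

/-- `P[f₀(s)] = f₀(s) - ∇π[f₀(s)]` pointwise. [folklore] -/
theorem locProjForce_apply :
    locProjForce χ u p t x = locForce χ u p t x - gradient (divPotential (locForce χ u p t)) x :=
  rfl

/-- Unfolding `locForcing`. [folklore] -/
theorem locForcing_apply (s₀ : ℝ) :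
    locForcing χ u p s₀ t x = ∫ s in Ioo s₀ t, heatFlow (locProjForce χ u p s) (t - s) x := rfl

/-- At the base time the forcing term vanishes (empty time interval). [folklore] -/
theorem locForcing_self (s₀ : ℝ) : locForcing χ u p s₀ s₀ x = 0 := by
  rw [locForcing_apply, Ioo_self, Measure.restrict_empty, integral_zero_measure]

/-- **The Leray–Helmholtz splitting of the localised velocity**: `a(t) + b(t) = v(t)`
pointwise. [cite: MajdaBertozziCUP2002, §1.8 Prop. 1.16 (1.91)] -/
theorem locSolPart_add_locGradPart :
    locSolPart χ u t x + locGradPart χ u t x = locVelocity χ u t x :=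
  classicalLerayProj_add_gradient _ _

/-- `a(t) = v(t) - b(t)` pointwise. [folklore] -/
theorem locSolPart_apply :
    locSolPart χ u t x = locVelocity χ u t x - locGradPart χ u t x := rfl

/-- The localised velocity as a function: `v(t) = fun x => χ x • u t x`. [folklore] -/
theorem locVelocity_eq_fun : locVelocity χ u t = fun y => χ y • u t y := rfl

/-- Off the support of the cut-off the localised velocity vanishes. [folklore] -/
theorem locVelocity_eq_zero_of_notMem {χ : EuclideanSpace ℝ (Fin 3) → ℝ}
    {x : EuclideanSpace ℝ (Fin 3)} (hx : x ∉ tsupport χ)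
    (u : ℝ → EuclideanSpace ℝ (Fin 3) → EuclideanSpace ℝ (Fin 3)) (t : ℝ) :
    locVelocity χ u t x = 0 := by
  rw [locVelocity_apply, image_eq_zero_of_notMem_tsupport hx, zero_smul]

/-- Inside `B(x₁, R - 2)` the bounded extension is the velocity. [folklore] -/
theorem locExtension_of_mem {x₁ x : EuclideanSpace ℝ (Fin 3)} {R : ℝ} (hx : x ∈ ball x₁ (R - 2))
    (u : ℝ → EuclideanSpace ℝ (Fin 3) → EuclideanSpace ℝ (Fin 3)) (t : ℝ) :
    locExtension x₁ R u t x = u t x := by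
  rw [locExtension_apply, indicator_of_mem hx]

/-- Off `B(x₁, R - 2)` the bounded extension vanishes. [folklore] -/
theorem locExtension_of_notMem {x₁ x : EuclideanSpace ℝ (Fin 3)} {R : ℝ}
    (hx : x ∉ ball x₁ (R - 2))
    (u : ℝ → EuclideanSpace ℝ (Fin 3) → EuclideanSpace ℝ (Fin 3)) (t : ℝ) :
    locExtension x₁ R u t x = 0 := by
  rw [locExtension_apply, indicator_of_notMem hx]

end Unfold

/-! ### The cut-off: elementary consequences -/

namespace IsLocCutoff

variable {x₁ : EuclideanSpace ℝ (Fin 3)} {R : ℝ} {χ : EuclideanSpace ℝ (Fin 3) → ℝ}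

/-- The cut-off has compact support. [folklore] -/
theorem hasCompactSupport (h : IsLocCutoff x₁ R χ) : HasCompactSupport χ :=
  HasCompactSupport.of_support_subset_isCompact (isCompact_closedBall x₁ (R - 3))
    (subset_tsupport χ |>.trans h.tsupport_subset)

/-- The support of the cut-off lies in the open ball `B(x₁, R - 2)`. [folklore] -/
theorem tsupport_subset_ball (h : IsLocCutoff x₁ R χ) : tsupport χ ⊆ ball x₁ (R - 2) :=
  h.tsupport_subset.trans (closedBall_subset_ball (by linarith))

/-- The support of the cut-off lies in the data ball `B(x₁, R)`. [folklore] -/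
theorem tsupport_subset_ball' (h : IsLocCutoff x₁ R χ) : tsupport χ ⊆ ball x₁ R :=
  h.tsupport_subset.trans (closedBall_subset_ball (by linarith))

/-- `|χ| ≤ 1`. [folklore] -/
theorem abs_le_one (h : IsLocCutoff x₁ R χ) (x : EuclideanSpace ℝ (Fin 3)) : |χ x| ≤ 1 :=
  abs_le.2 ⟨by linarith [h.nonneg x], h.le_one x⟩

/-- Off `B̄(x₁, R - 3)` the cut-off vanishes. [folklore] -/
theorem eq_zero_of_lt (h : IsLocCutoff x₁ R χ) {x : EuclideanSpace ℝ (Fin 3)}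
    (hx : R - 3 < dist x x₁) : χ x = 0 :=
  image_eq_zero_of_notMem_tsupport fun hx' => (mem_closedBall.1 (h.tsupport_subset hx')).not_gt hx

/-- The derivative of the cut-off vanishes off its support, in particular on `B(x₁, R - 4)ᶜᶜ`…:
at points of the open ball `B(x₁, R - 4)` (where `χ ≡ 1` near the point). [folklore] -/
theorem fderiv_eq_zero_of_mem (h : IsLocCutoff x₁ R χ) {x : EuclideanSpace ℝ (Fin 3)}
    (hx : x ∈ ball x₁ (R - 4)) : fderiv ℝ χ x = 0 := by
  have hev : χ =ᶠ[𝓝 x] fun _ => (1 : ℝ) := by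
    filter_upwards [isOpen_ball.mem_nhds hx] with y hy
    exact h.eq_one y (ball_subset_closedBall hy)
  rw [hev.fderiv_eq, fderiv_const_apply]

end IsLocCutoff

/-! ### Classical solutions on the cylinder: elementary consequences -/

namespace IsCylinderSolution

variable {x₁ : EuclideanSpace ℝ (Fin 3)} {δ R : ℝ}
  {u : ℝ → EuclideanSpace ℝ (Fin 3) → EuclideanSpace ℝ (Fin 3)}
  {p : ℝ → EuclideanSpace ℝ (Fin 3) → ℝ}

/-- The open cylinder is open. [folklore] -/
theorem isOpen_cylinder (x₁ : EuclideanSpace ℝ (Fin 3)) (δ R : ℝ) :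
    IsOpen (Ioo (-δ) (R ^ 2) ×ˢ ball x₁ R) :=
  isOpen_Ioo.prod isOpen_ball

/-- The velocity slice `u(t)` is smooth on the ball. [folklore] -/
theorem contDiffOn_velocity_slice (h : IsCylinderSolution x₁ δ R u p) {t : ℝ}
    (ht : t ∈ Ioo (-δ) (R ^ 2)) : ContDiffOn ℝ ∞ (u t) (ball x₁ R) := by
  have h1 : ContDiffOn ℝ ∞ (fun y : EuclideanSpace ℝ (Fin 3) => ((t, y) : ℝ × _)) (ball x₁ R) :=
    (contDiffOn_const.prodMk contDiffOn_id)
  exact h.smooth_velocity.comp h1 fun y hy => ⟨ht, hy⟩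

/-- The pressure slice `p(t)` is smooth on the ball. [folklore] -/
theorem contDiffOn_pressure_slice (h : IsCylinderSolution x₁ δ R u p) {t : ℝ}
    (ht : t ∈ Ioo (-δ) (R ^ 2)) : ContDiffOn ℝ ∞ (p t) (ball x₁ R) := by
  have h1 : ContDiffOn ℝ ∞ (fun y : EuclideanSpace ℝ (Fin 3) => ((t, y) : ℝ × _)) (ball x₁ R) :=
    (contDiffOn_const.prodMk contDiffOn_id)
  exact h.smooth_pressure.comp h1 fun y hy => ⟨ht, hy⟩

/-- The velocity is continuous on the cylinder. [folklore] -/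
theorem continuousOn_velocity (h : IsCylinderSolution x₁ δ R u p) :
    ContinuousOn (uncurry u) (Ioo (-δ) (R ^ 2) ×ˢ ball x₁ R) :=
  h.smooth_velocity.continuousOn

/-- The pressure is continuous on the cylinder. [folklore] -/
theorem continuousOn_pressure (h : IsCylinderSolution x₁ δ R u p) :
    ContinuousOn (uncurry p) (Ioo (-δ) (R ^ 2) ×ˢ ball x₁ R) :=
  h.smooth_pressure.continuousOn

end IsCylinderSolution

end BGK2015

end Literature.Analysis.FluidPDE
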